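import Summits.BirchSwinnertonDyer.BirchSwinnertonDyer.Theorems.AdditiveBranchIMCGordTwoRankZeroThreeDoor
import Summits.BirchSwinnertonDyer.Rank1Residual.Supersingular.DescentLowerBound
import Summits.BirchSwinnertonDyer.Rank1Residual.Additive.X4SharpThreeAssembly
import Literature.NumberTheory.EllipticCurves.NonEisensteinPrimeOfSurjective
import HarnessLib

/-!
# Route `AdditiveBranchIMC` (rung K1), crux `GordTwoRankZeroOffCaseOne` (item 19357): the rank-ZERO `p`-DESCENT door —
# `BSD(E,p)` on cell (G-ord, `e = 2`) ∩ surj ∩ `r_an = 0` ∩ `ord_p #Ш_an ≤ 2` from ONE native certificate line `Sel^(p)(E/ℚ) ≠ 0`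
# (cell `bsd-addord`, seat `bsd-addord-k1-c2` gen 7, D-0074 row B1; planner KUR3-COVERAGE-v1 §2 road (R2) at `p = 3`)

HONEST FRAMING. THEOREMS ONLY: no definition, no named fact, no `sorry`, nothing booked; BSD is not proved by any of
this; the crux stays OPEN at class level. Pure composition of tree theorems:
* the class-free LOWER half from the native `p`-descent certificate (cell b2b-bsdres / bsd-potss, PROVED in the tree below
  the named facts): `r_an = 0` ⟹ rank `0` and `Ш` finite (GZK `hGZK`); `E[p]` irreducible ⟹ `p ∤ #E(ℚ)_tors` (Mazur;
  `Supersingular.not_dvd_torsionOrder_of_irr`); hence `Sel^(p)(E/ℚ) ≅ Ш(E/ℚ)[p]`, so `Sel^(p) ≠ 0` gives `p ∣ #Ш`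
  (`exists_sha_torsion_of_selmerGroup_ne_bot`, the PROVED fundamental sequence) and Cassels–Tate squareness (`hCT`) gives
  `p² ∣ #Ш`, i.e. `ord_p #Ш_an ≤ 2 ≤ ord_p #Ш` (`Supersingular.missingLowerBoundAt_of_casselsTate_of_selmerGroup_ne_bot`);
* the UPPER half on cell (G-ord, `e = 2`) ∩ surj ∩ `r_an = 0` at EVERY odd `p`, `p = 3` INCLUDED, from the register fact `hK`
  (Kato 2004 Thm. 17.4 (3), Wuthrich's half-eigenspace reading), Delbourgo 1998 Prop. 4 `hDel98`, GZK, modularity — gen 6's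
  door `bsdp_rankZero_of_cellGordTwo_of_surj_of_lower_of_katoHalf` (file `…ThreeDoor`; NO Tamagawa / Manin / `j`-witness /
  `p ≥ 5` hypothesis: the `p`-adic tower comes from `ρ̄_{E,p}` onto on this cell).
So on these rows `BSD(E,p)` ⟸ {hCT, hK, hDel98, hGZK, hmod, hmodD} + row data (`CellGordTwo`, surj, `r_an = 0`,
`#Ш_an = q` with `ord_p q ≤ 2`) + ONE binder `hSel : Sel^(p)(E/ℚ) ≠ ⊥`, whose per-pair EVIDENCE is an explicit `p`-descent
element (at `p = 3`: the Schaefer–Stoll engines of cell b2b-bsdres, x11b `desc3lib.gp` / x11c `descentPlib.gp`) — the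
partner-free twin of the seat's companion road (`missingLowerBoundAt_c<E>_3` + `…ThreeDoor`), reaching EVERY
(3, X4♯(G-ord, e = 2)) ∩ surj ∩ `r_an = 0` ∩ `ord₃ #Ш_an = 2` row (planner `KUR3-COVERAGE-v1.md` §1: U(s = 2) Gord 300 + C Gord),
with or without a congruent rank-two partner; the referee's precedent for the certificate tier is R139.1 (5568g1 / 19776h1 @3,
desc3 + Cassels–Tate, flag-free). §1 = cell (G-ord, `e = 2`), every odd `p` (cell / booking-table / `p = 3` / isogeny-class
forms); §2 = the X4♯(3) form for the OTHER potentially good sub-types at `3` (wild, tame `e = 4`, supersingular twist) through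
additive-p4's `X4RankZero.bsdp_three_of_cert_of_lower` (Kato 14.5 (3) `hKato` + the (M) facts; `3 ∤ ∏ c_ℓ`, a `3`-adic image
certificate and a Manin datum `3 ∤ c_D` — the V20X booking grammar), offered to the owners of those rows; nothing of theirs
is restated. References: [Kato2004Asterisque] Thm. 17.4 (3) (p. 273), Thm. 14.5 (3) (p. 236); [Delbourgo1998] Prop. 4 (p. 144);
[Wuthrich2014] §3 (p. 390); [SilvermanAEC2009] Thm. X.4.2(a), Thm. X.4.14; [Cassels1965ArithmeticVIII]; [MilneADT2006] Thm. I.7.3;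
[Miller2011LMS] Def. 1.1; [SchaeferStoll2004] (the certificate engine); [Mazur1978] Prop. 6.3.
-/

noncomputable section

open scoped Classical

open WeierstrassCurve Literature.NumberTheory.EllipticCurves
  Literature.NumberTheory.EllipticCurves.ModularForms
  Literature.NumberTheory.EllipticCurves.Rank1Residual
  Literature.NumberTheory.EllipticCurves.Rank1Residual.Typed
  Literature.NumberTheory.GaloisRepresentations

set_option linter.dupNamespace false
set_option autoImplicit false

namespace Summit.BirchSwinnertonDyer.BirchSwinnertonDyer.Theorems.AdditiveBranchIMCGordTwoRankZeroDesc3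

open Summit.BirchSwinnertonDyer.Rank1Residual
open Summit.BirchSwinnertonDyer.Rank1Residual.Additive
open Summit.BirchSwinnertonDyer.BirchSwinnertonDyer.Theorems.AdditiveBranchIMCGordTwoRankZeroCompanion

/-! ### §1 Cell (G-ord, `e = 2`) ∩ surj ∩ `r_an = 0`, every odd `p` -/

section Cell

variable {W : WeierstrassCurve ℚ} [W.IsElliptic] [W.IsGloballyMinimal] {p : ℕ} [hp : Fact p.Prime]

omit [W.IsGloballyMinimal] in
/-- **The LOWER half from the native `p`-descent certificate under `ρ̄_{E,p}` onto (class-free, every `p`).** At a pair with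
`r_an = 0`, `#Ш_an = q` with `ord_p q ≤ 2`, `ρ̄_{E,p}` onto and `Sel^(p)(E/ℚ) ≠ 0`: `ord_p #Ш_an ≤ ord_p #Ш(E)`. The side
condition `p ∤ #E(ℚ)_tors` of `Supersingular.missingLowerBoundAt_of_casselsTate_of_selmerGroup_ne_bot` is DERIVED (onto ⟹
irreducible ⟹ no rational `p`-torsion). [cite: SilvermanAEC2009, Thm. X.4.2(a) and Thm. X.4.14] [cite: Miller2011LMS, Def. 1.1] -/
theorem missingLowerBoundAt_rankZero_of_surj_of_selmerGroup_ne_bot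
    (hCT : exists_casselsTate_pairing (K := ℚ)) (hGZK : rank_eq_analyticRank_of_analyticRank_le_one)
    (hsurj : Surj W p) (hr : W.analyticRank = 0) {q : ℚ} (hq : shaAn W = (q : ℂ)) (hv : padicValRat p q ≤ 2)
    (hSel : W.selmerGroup (p : ℤ) ≠ ⊥) : MissingLowerBoundAt W p :=
  Supersingular.missingLowerBoundAt_of_casselsTate_of_selmerGroup_ne_bot W p hCT hGZK hr
    (Supersingular.not_dvd_torsionOrder_of_irr W p (hasIrreducibleModPGaloisRep_of_hasSurjectiveModNGaloisRep W p hsurj))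
    hq hv hSel

/-- **The rank-ZERO `p`-descent door on cell (G-ord, `e = 2`) ∩ surj ∩ `r_an = 0`, every odd `p` (`p = 3` included):
`BSD(E,p)` from the register facts {hCT, hK, hDel98, hGZK, hmod, hmodD}, the row data and ONE certificate line
`Sel^(p)(E/ℚ) ≠ 0`** (`ord_p #Ш_an ≤ 2`). LOWER half: the native certificate through Cassels–Tate (above); UPPER half: gen 6's
`bsdp_rankZero_of_cellGordTwo_of_surj_of_lower_of_katoHalf` (Kato's component divisibility on the good ordinary twist, tower from
`ρ̄_{E,p}` onto). No Tamagawa / Manin / `j`-witness / partner hypothesis. Per pair; nothing booked.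
[cite: Kato2004Asterisque, Thm. 17.4 (3) (p. 273)] [cite: Wuthrich2014, §3 (p. 390)] [cite: Delbourgo1998, Prop. 4 (p. 144)]
[cite: SilvermanAEC2009, Thm. X.4.14] [cite: Miller2011LMS, §1 and Def. 1.1] -/
theorem bsdp_rankZero_of_cellGordTwo_of_surj_of_selmerGroup_ne_bot
    (hCT : exists_casselsTate_pairing (K := ℚ))
    (hK : Wuthrich2014.kato_halfEigenCharIdeal_dvd_cyclotomicPrime_of_surjective)
    (hDel98 : Delbourgo1998.prop4_rankZero_pow_dvd_constantCoeff)
    (hGZK : rank_eq_analyticRank_of_analyticRank_le_one) (hmod : hasEntireLFunction_rat)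
    (hmodD : nonempty_modularParametrizationData)
    (hc : N10.CellGordTwo W p) (hsurj : Surj W p) (hr : W.analyticRank = 0)
    {q : ℚ} (hq : shaAn W = (q : ℂ)) (hv : padicValRat p q ≤ 2) (hSel : W.selmerGroup (p : ℤ) ≠ ⊥) : BSDp W p :=
  bsdp_rankZero_of_cellGordTwo_of_surj_of_lower_of_katoHalf hK hDel98 hGZK hmod hmodD hc hsurj hr
    (missingLowerBoundAt_rankZero_of_surj_of_selmerGroup_ne_bot hCT hGZK hsurj hr hq hv hSel)

/-- **Booking-table currency**: `BSD(E,p)` on X4♯(G-ord) ∩ `I₀*` (`e = 2`) ∩ surj ∩ `r_an = 0` ∩ `ord_p #Ш_an ≤ 2` from the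
certificate line `Sel^(p)(E/ℚ) ≠ 0`, every odd `p`. [cite: Kato2004Asterisque, Thm. 17.4 (3) (p. 273)] [cite: Wuthrich2014, §3 (p. 390)]
[cite: Delbourgo1998, Prop. 4 (p. 144)] [cite: SilvermanAEC2009, Thm. X.4.14] [cite: Miller2011LMS, §1 and Def. 1.1] -/
theorem bsdp_rankZero_of_classX4Gord_of_surj_of_selmerGroup_ne_bot
    (hCT : exists_casselsTate_pairing (K := ℚ))
    (hK : Wuthrich2014.kato_halfEigenCharIdeal_dvd_cyclotomicPrime_of_surjective)
    (hDel98 : Delbourgo1998.prop4_rankZero_pow_dvd_constantCoeff)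
    (hGZK : rank_eq_analyticRank_of_analyticRank_le_one) (hmod : hasEntireLFunction_rat)
    (hmodD : nonempty_modularParametrizationData)
    (hX : ClassX4Gord W p) (he : semistabilityIndex W p = 2) (hsurj : Surj W p) (hr : W.analyticRank = 0)
    {q : ℚ} (hq : shaAn W = (q : ℂ)) (hv : padicValRat p q ≤ 2) (hSel : W.selmerGroup (p : ℤ) ≠ ⊥) : BSDp W p :=
  bsdp_rankZero_of_classX4Gord_of_surj_of_lower_of_katoHalf hK hDel98 hGZK hmod hmodD hX he hsurj hr
    (missingLowerBoundAt_rankZero_of_surj_of_selmerGroup_ne_bot hCT hGZK hsurj hr hq hv hSel)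

/-- **ISOGENY-CLASS form** (Cassels `hCassels`): `BSD(E',p)` for every globally minimal `E'` `ℚ`-isogenous to a certified row `E`.
[cite: MilneADT2006, Thm. I.7.3 and Remark I.7.4] [cite: Kato2004Asterisque, Thm. 17.4 (3) (p. 273)] [cite: SilvermanAEC2009, Thm. X.4.14]
[cite: Miller2011LMS, §1 and Def. 1.1] -/
theorem isogenous_bsdp_rankZero_of_classX4Gord_of_surj_of_selmerGroup_ne_bot
    (hCassels : bsdRHS_eq_of_isIsogenous) (hCT : exists_casselsTate_pairing (K := ℚ))
    (hK : Wuthrich2014.kato_halfEigenCharIdeal_dvd_cyclotomicPrime_of_surjective)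
    (hDel98 : Delbourgo1998.prop4_rankZero_pow_dvd_constantCoeff)
    (hGZK : rank_eq_analyticRank_of_analyticRank_le_one) (hmod : hasEntireLFunction_rat)
    (hmodD : nonempty_modularParametrizationData)
    {W' : WeierstrassCurve ℚ} [W'.IsElliptic] [W'.IsGloballyMinimal] (hiso : IsIsogenous W' W)
    (hX : ClassX4Gord W p) (he : semistabilityIndex W p = 2) (hsurj : Surj W p) (hr : W.analyticRank = 0)
    {q : ℚ} (hq : shaAn W = (q : ℂ)) (hv : padicValRat p q ≤ 2) (hSel : W.selmerGroup (p : ℤ) ≠ ⊥) : BSDp W' p :=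
  isogenous_bsdp_rankZero_of_classX4Gord_of_surj_of_lower_of_katoHalf hCassels hK hDel98 hGZK hmod hmodD hiso hX he hsurj hr
    (missingLowerBoundAt_rankZero_of_surj_of_selmerGroup_ne_bot hCT hGZK hsurj hr hq hv hSel)

end Cell

/-! ### §1′ `p = 3` (`e = 2` automatic on X4♯(G-ord) at `3`) -/

section CellThree

variable {W : WeierstrassCurve ℚ} [W.IsElliptic] [W.IsGloballyMinimal]

/-- **`p = 3`: `BSD(E,3)` on X4♯(G-ord) ∩ surj(3) ∩ `r_an = 0` ∩ `ord₃ #Ш_an ≤ 2` from the certificate line `Sel^(3)(E/ℚ) ≠ 0`**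
(`e = 2` automatic at `3`; the `3`-adic tower from `ρ̄₃` onto on the good ordinary twist). The road (R2) of the planner's
`KUR3-COVERAGE-v1.md` §2 on the Gord sub-block. [cite: Kato2004Asterisque, Thm. 17.4 (3) (p. 273)] [cite: Wuthrich2014, §3 (p. 390) and App. B]
[cite: Greenberg1991, §2 (p. 214)] [cite: Delbourgo1998, Prop. 4 (p. 144)] [cite: SilvermanAEC2009, Thm. X.4.14] [cite: Miller2011LMS, §1 and Def. 1.1] -/
theorem bsdp_rankZero_three_of_classX4Gord_of_surj_of_selmerGroup_ne_bot
    (hCT : exists_casselsTate_pairing (K := ℚ))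
    (hK : Wuthrich2014.kato_halfEigenCharIdeal_dvd_cyclotomicPrime_of_surjective)
    (hDel98 : Delbourgo1998.prop4_rankZero_pow_dvd_constantCoeff)
    (hGZK : rank_eq_analyticRank_of_analyticRank_le_one) (hmod : hasEntireLFunction_rat)
    (hmodD : nonempty_modularParametrizationData)
    (hX : ClassX4Gord W 3) (hsurj : Surj W 3) (hr : W.analyticRank = 0)
    {q : ℚ} (hq : shaAn W = (q : ℂ)) (hv : padicValRat 3 q ≤ 2) (hSel : W.selmerGroup (3 : ℤ) ≠ ⊥) : BSDp W 3 :=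
  haveI : Fact (Nat.Prime 3) := ⟨Nat.prime_three⟩
  bsdp_rankZero_three_of_classX4Gord_of_surj_of_lower_of_katoHalf hK hDel98 hGZK hmod hmodD hX hsurj hr
    (missingLowerBoundAt_rankZero_of_surj_of_selmerGroup_ne_bot hCT hGZK hsurj hr hq hv hSel)

/-- **`p = 3`, ISOGENY-CLASS form** (Cassels `hCassels`). [cite: MilneADT2006, Thm. I.7.3 and Remark I.7.4]
[cite: Kato2004Asterisque, Thm. 17.4 (3) (p. 273)] [cite: SilvermanAEC2009, Thm. X.4.14] [cite: Miller2011LMS, §1 and Def. 1.1] -/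
theorem isogenous_bsdp_rankZero_three_of_classX4Gord_of_surj_of_selmerGroup_ne_bot
    (hCassels : bsdRHS_eq_of_isIsogenous) (hCT : exists_casselsTate_pairing (K := ℚ))
    (hK : Wuthrich2014.kato_halfEigenCharIdeal_dvd_cyclotomicPrime_of_surjective)
    (hDel98 : Delbourgo1998.prop4_rankZero_pow_dvd_constantCoeff)
    (hGZK : rank_eq_analyticRank_of_analyticRank_le_one) (hmod : hasEntireLFunction_rat)
    (hmodD : nonempty_modularParametrizationData)
    {W' : WeierstrassCurve ℚ} [W'.IsElliptic] [W'.IsGloballyMinimal] (hiso : IsIsogenous W' W)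
    (hX : ClassX4Gord W 3) (hsurj : Surj W 3) (hr : W.analyticRank = 0)
    {q : ℚ} (hq : shaAn W = (q : ℂ)) (hv : padicValRat 3 q ≤ 2) (hSel : W.selmerGroup (3 : ℤ) ≠ ⊥) : BSDp W' 3 :=
  haveI : Fact (Nat.Prime 3) := ⟨Nat.prime_three⟩
  isogenous_bsdp_rankZero_three_of_classX4Gord_of_surj_of_lower_of_katoHalf hCassels hK hDel98 hGZK hmod hmodD hiso hX hsurj hr
    (missingLowerBoundAt_rankZero_of_surj_of_selmerGroup_ne_bot hCT hGZK hsurj hr hq hv hSel)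

end CellThree

/-! ### §2 The X4♯(3) form for the other potentially good sub-types at `3` (additive-p4's assembly + the certificate line) -/

section X4SharpThree

variable (W : WeierstrassCurve ℚ) [W.IsElliptic] [W.IsGloballyMinimal]

/-- **`BSD(E,3)` on an X4♯(3) row (`E[3]`-surjective, `r_an = 0`, ANY potentially good or potentially multiplicative type at `3`)
with `ord₃ #Ш_an ≤ 2` from the certificate line `Sel^(3)(E/ℚ) ≠ 0`** — additive-p4's `X4RankZero.bsdp_three_of_cert_of_lower`
(UPPER half: (M) branch Delbourgo 1998 Prop. 4 + Wuthrich 2014 Lemma 20 + Kato's `ω`-component divisibility, NO Tamagawa / Manin;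
potentially good branch Kato 2004 Thm. 14.5 (3) `hKato` under `3 ∤ ∏ c_ℓ`, a `3`-adic image certificate [`ord₃ j < 0` ∨ `j`-witness ∨
surj(9)] and a modular parametrisation datum `D` with `3 ∤ c_D`) fed with the class-free LOWER half from the native certificate
(`E[3]` irreducible is part of `ClassX4`). The road (R2) of `KUR3-COVERAGE-v1.md` §2 for the W / T′ / Gss2 sub-blocks (owners: cell
bsd-potss / the W-ALL wall), offered as is; per pair; nothing booked here. [cite: Kato2004Asterisque, Thm. 14.5 (3) (p. 236), Thm. 17.4 (3) (p. 273)]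
[cite: Delbourgo1998, Prop. 4 (p. 144)] [cite: Wuthrich2014, Lemma 20 (p. 399)] [cite: SilvermanAEC2009, Thm. X.4.14] [cite: Miller2011LMS, §1 and Def. 1.1] -/
theorem bsdp_three_of_x4Cert_of_selmerGroup_ne_bot
    (hKato : Kato2004.rankZero_padicValNat_sha_le_of_additive_potGood_of_imageContainsSL2)
    (hDel : Delbourgo1998.prop4_rankZero_pow_dvd_constantCoeff)
    (hGZK : rank_eq_analyticRank_of_analyticRank_le_one) (hmod : hasEntireLFunction_rat)
    (hmodD : nonempty_modularParametrizationData)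
    (hL20 : Wuthrich2014.lemma20_surjective_threeAdic_of_semistable)
    (hKatoω : Wuthrich2014.kato_minusEigenCharIdeal_dvd_cyclotomicThree_of_surjective)
    (hCT : exists_casselsTate_pairing (K := ℚ))
    (hr : W.analyticRank = 0) (hX : ClassX4 W 3) (hsurj : Surj W 3)
    (hcert : padicValRat 3 W.j < 0 ∨
      (∃ q : ℕ, q.Prime ∧ q ≠ 3 ∧ padicValRat q W.j < 0 ∧ ¬ (3 : ℤ) ∣ padicValRat q W.j) ∨
        W.HasSurjectiveModNGaloisRep 9)
    (htam : ¬ 3 ∣ W.tamagawaProduct)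
    {N : ℕ} [NeZero N] (D : ModularParametrizationData W N) (hc : ¬ (3 : ℤ) ∣ D.maninConstant)
    {q : ℚ} (hq : shaAn W = (q : ℂ)) (hv : padicValRat 3 q ≤ 2) (hSel : W.selmerGroup (3 : ℤ) ≠ ⊥) : BSDp W 3 :=
  haveI : Fact (Nat.Prime 3) := ⟨Nat.prime_three⟩
  X4RankZero.bsdp_three_of_cert_of_lower W hKato hDel hGZK hmod hmodD hL20 hKatoω hr hX hsurj hcert htam D hc
    (Supersingular.missingLowerBoundAt_of_casselsTate_of_selmerGroup_ne_bot W 3 hCT hGZK hr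
      (Supersingular.not_dvd_torsionOrder_of_irr W 3 hX.2.2) hq hv hSel)

/-- **ISOGENY-CLASS form of the X4♯(3) certificate door** (Cassels `hCassels`): `BSD(E',3)` at every globally minimal `E'`
`ℚ`-isogenous to the certified member `E` (the member carrying surj(3), `3 ∤ ∏ c_ℓ`, the image certificate, the Manin datum and
the Selmer line). [cite: MilneADT2006, Thm. I.7.3 and Remark I.7.4] [cite: Kato2004Asterisque, Thm. 14.5 (3) (p. 236)]
[cite: SilvermanAEC2009, Thm. X.4.14] [cite: Miller2011LMS, §1 and Def. 1.1] -/
theorem isogenous_bsdp_three_of_x4Cert_of_selmerGroup_ne_bot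
    (hCassels : bsdRHS_eq_of_isIsogenous)
    (hKato : Kato2004.rankZero_padicValNat_sha_le_of_additive_potGood_of_imageContainsSL2)
    (hDel : Delbourgo1998.prop4_rankZero_pow_dvd_constantCoeff)
    (hGZK : rank_eq_analyticRank_of_analyticRank_le_one) (hmod : hasEntireLFunction_rat)
    (hmodD : nonempty_modularParametrizationData)
    (hL20 : Wuthrich2014.lemma20_surjective_threeAdic_of_semistable)
    (hKatoω : Wuthrich2014.kato_minusEigenCharIdeal_dvd_cyclotomicThree_of_surjective)
    (hCT : exists_casselsTate_pairing (K := ℚ))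
    {W' : WeierstrassCurve ℚ} [W'.IsElliptic] [W'.IsGloballyMinimal] (hiso : IsIsogenous W' W)
    (hr : W.analyticRank = 0) (hX : ClassX4 W 3) (hsurj : Surj W 3)
    (hcert : padicValRat 3 W.j < 0 ∨
      (∃ q : ℕ, q.Prime ∧ q ≠ 3 ∧ padicValRat q W.j < 0 ∧ ¬ (3 : ℤ) ∣ padicValRat q W.j) ∨
        W.HasSurjectiveModNGaloisRep 9)
    (htam : ¬ 3 ∣ W.tamagawaProduct)
    {N : ℕ} [NeZero N] (D : ModularParametrizationData W N) (hc : ¬ (3 : ℤ) ∣ D.maninConstant)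
    {q : ℚ} (hq : shaAn W = (q : ℂ)) (hv : padicValRat 3 q ≤ 2) (hSel : W.selmerGroup (3 : ℤ) ≠ ⊥) : BSDp W' 3 := by
  haveI : Fact (Nat.Prime 3) := ⟨Nat.prime_three⟩
  have hr' : W'.analyticRank ≤ 1 := by rw [analyticRank_eq_of_isIsogenous' hiso, hr]; exact zero_le_one
  exact N10.bsdp_of_isIsogenous_of_bsdp 3 hCassels hGZK hmod hiso hr'
    (bsdp_three_of_x4Cert_of_selmerGroup_ne_bot W hKato hDel hGZK hmod hmodD hL20 hKatoω hCT hr hX hsurj hcert htam D hc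
      hq hv hSel)

end X4SharpThree

end Summit.BirchSwinnertonDyer.BirchSwinnertonDyer.Theorems.AdditiveBranchIMCGordTwoRankZeroDesc3

end
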